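import Literature.Topology.FourManifolds.GenusThreePrimitiveOrReducing

/-!
# Crux `WeakReductionDescent.DependentTripleGenusThreeStandard` (stmt-SmoothPoincare4-18000), line
# `Sketch`, skeleton v13: the slide lemma from seam normal form and the Fig. 19 slides

Reduction glue for the registered skeleton v13 of the crux (`Cruxes/…/Lines/Sketch.lean`), filed
`--supports stmt-SmoothPoincare4-18000` (registered helper
`helper_fiveChainOfDuals_of_biDual_of_disjoint`).  PROVED; pure combinatorics on `Fin 3` over the
concrete-curve vocabulary (`IsCurve`, `BoundsDisc`, `MeetsOnceTransv`).

In v13 the apex of the line — the only part of Aranda–Zupan's proof of Thm 1.4 (arXiv:2503.04607,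
§7 pp. 25–26) that is neither a named Literature fact nor proved glue — is the curve calculus on
the genus-three central surface `F`, split into two registered stubs: **α** (seam normal form: a
dual of the cuff `f i` in `H_j` missing `f j` can be replaced by one that also meets the third
cuff `f l` once transversally — general position and wave removal by slides over `f j`, p. 25)
and **β** (Fig. 19: the two bi-duals of a fork can be made disjoint by slides of one over its own
cuff along arcs of the other, p. 26).  This file proves that α and β give the SLIDE LEMMA of v12:
a pants-type triple with a dual for every ordered pair of cuffs carries a concrete five-chain
centred at some cuff.  The proof is the fork combinatorics behind the printed sentence "These two
possibilities are symmetric up to permutation of `α`, `β`, and `γ`": after α every dual is a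
bi-dual, so for each of the three pairs of colours one of the two colours RECEIVES a bi-dual
(a compressing curve of its handlebody missing its cuff and dual to both other cuffs); hence two
distinct colours `j`, `l` receive bi-duals (if `0` does not, `1` and `2` do), the third colour
`p` is the centre, and β makes the two neighbours disjoint.

References: R. Aranda, A. Zupan, arXiv:2503.04607 (2025), §7 (pp. 25–26), Fig. 19.
-/

noncomputable section

set_option linter.dupNamespace false

open scoped Manifold ContDiff Topology
open Set
open Literature.Topology.FourManifolds
open Literature.Topology.FourManifolds.Trisection

namespace Summit.SmoothPoincare4.SmoothPoincare4.Theorems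

/-- **v12's slide lemma (pants triple + duals ⇒ a concrete five-chain) from stubs α and β**
(PROVED glue; registered helper of crux stmt-SmoothPoincare4-18000, line `Sketch`, skeleton v13: stubs α + β ⟹ v12's slide lemma; the fork combinatorics — "These two possibilities are symmetric up to permutation of
`α`, `β`, and `γ`", p. 25).  Say colour `j` RECEIVES a bi-dual if some compressing curve of `H_j`
missing `f j` meets both other cuffs once transversally.  By stub α every dual of the hypothesis
(for the pair `{i, j}`: a dual of `f i` in `H_j`, or of `f j` in `H_i`) makes `j` resp. `i`
receive a bi-dual; so for every pair one of its two colours receives one, whence two distinct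
colours `j`, `l` receive bi-duals (if colour `0` does not, colours `1` and `2` do); with `p` the
third colour these are the fork's neighbours `nj`, `nl`, and stub β makes them disjoint.
[cite: ArandaZupan2025, §7 (pp. 25–26)] -/
theorem helper_fiveChainOfDuals_of_biDual_of_disjoint :
    (∀ (M : Type) [TopologicalSpace M] [T2Space M] [SecondCountableTopology M] [ChartedSpace (EuclideanSpace ℝ (Fin 4)) M] [IsManifold (𝓡 4) ∞ M], ∀ (k : Fin 3 → ℕ) (T : Fin 3 → Set M), IsGKTrisection M 3 k T → ∀ f : Fin 3 → Set M, ((∀ i, IsCurve T (f i)) ∧ (Pairwise fun i j => Disjoint (f i) (f j)) ∧ (∀ i, IsNonSeparating T (f i)) ∧ (∀ i, BoundsDisc T (spineHandlebody T i) (f i)) ∧ (∀ i j, i ≠ j → IsConnected (centralSurfaceSet T \ (f i ∪ f j))) ∧ ¬ IsPreconnected (centralSurfaceSet T \ ⋃ i, f i)) → ∀ i j l : Fin 3, i ≠ j → i ≠ l → j ≠ l → ∀ y' : Set M, IsCurve T y' → BoundsDisc T (spineHandlebody T j) y' → MeetsOnceTransv y' (f i) → Disjoint y' (f j) → ∃ y''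 : Set M, IsCurve T y'' ∧ BoundsDisc T (spineHandlebody T j) y'' ∧ Disjoint y'' (f j) ∧ MeetsOnceTransv y'' (f i) ∧ MeetsOnceTransv y'' (f l)) →
    (∀ (M : Type) [TopologicalSpace M] [T2Space M] [SecondCountableTopology M] [ChartedSpace (EuclideanSpace ℝ (Fin 4)) M] [IsManifold (𝓡 4) ∞ M], ∀ (k : Fin 3 → ℕ) (T : Fin 3 → Set M), IsGKTrisection M 3 k T → ∀ f : Fin 3 → Set M, ((∀ i, IsCurve T (f i)) ∧ (Pairwise fun i j => Disjoint (f i) (f j)) ∧ (∀ i, IsNonSeparating T (f i)) ∧ (∀ i, BoundsDisc T (spineHandlebody T i) (f i)) ∧ (∀ i j, i ≠ j → IsConnected (centralSurfaceSet T \ (f i ∪ f j))) ∧ ¬ IsPreconnected (centralSurfaceSet T \ ⋃ i, f i)) → ∀ p j l : Fin 3, p ≠ j → p ≠ l → j ≠ l → ∀ nj nl : Set M, IsCurve T nj → IsCurve T nl → BoundsDisc T (spineHandlebody T j) nj → BoundsDisc T (spineHandlebody T l) nl → Disjoint nj (f j) → Disjoint nl (f l) → MeetsOnceTransv nj (f p)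 → MeetsOnceTransv nj (f l) → MeetsOnceTransv nl (f p) → MeetsOnceTransv nl (f j) → ∃ nl' : Set M, IsCurve T nl' ∧ BoundsDisc T (spineHandlebody T l) nl' ∧ Disjoint nl' (f l) ∧ MeetsOnceTransv nl' (f p) ∧ MeetsOnceTransv nl' (f j) ∧ Disjoint nj nl') →
        ∀ (M : Type) [TopologicalSpace M] [T2Space M] [SecondCountableTopology M]
      [ChartedSpace (EuclideanSpace ℝ (Fin 4)) M] [IsManifold (𝓡 4) ∞ M],
      ∀ (k : Fin 3 → ℕ) (T : Fin 3 → Set M), IsGKTrisection M 3 k T →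
      ∀ f : Fin 3 → Set M,
      ((∀ i, IsCurve T (f i)) ∧ (Pairwise fun i j => Disjoint (f i) (f j)) ∧
        (∀ i, IsNonSeparating T (f i)) ∧ (∀ i, BoundsDisc T (spineHandlebody T i) (f i)) ∧
        (∀ i j, i ≠ j → IsConnected (centralSurfaceSet T \ (f i ∪ f j))) ∧
        ¬ IsPreconnected (centralSurfaceSet T \ ⋃ i, f i)) →
      (∀ i j : Fin 3, i ≠ j →
        (∃ y' : Set M, IsCurve T y' ∧ BoundsDisc T (spineHandlebody T j) y' ∧
          MeetsOnceTransv y' (f i) ∧ Disjoint y' (f j)) ∨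
        (∃ x' : Set M, IsCurve T x' ∧ BoundsDisc T (spineHandlebody T i) x' ∧
          MeetsOnceTransv x' (f j) ∧ Disjoint x' (f i))) →
      ∃ (p j l : Fin 3) (nj nl : Set M), p ≠ j ∧ p ≠ l ∧ j ≠ l ∧
        IsCurve T nj ∧ IsCurve T nl ∧
        BoundsDisc T (spineHandlebody T j) nj ∧ BoundsDisc T (spineHandlebody T l) nl ∧
        Disjoint nj nl ∧ Disjoint nj (f j) ∧ Disjoint nl (f l) ∧
        MeetsOnceTransv nj (f p) ∧ MeetsOnceTransv nl (f p) ∧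
        MeetsOnceTransv nj (f l) ∧ MeetsOnceTransv nl (f j) := by
  intro hα hβ M _ _ _ _ _ k T hT f hf hduals
  -- colour `j` receives a bi-dual
  let In : Fin 3 → Prop := fun j => ∃ y'' : Set M, IsCurve T y'' ∧
    BoundsDisc T (spineHandlebody T j) y'' ∧ Disjoint y'' (f j) ∧
    ∀ i, i ≠ j → MeetsOnceTransv y'' (f i)
  have third : ∀ i j : Fin 3, i ≠ j → ∃ l : Fin 3, l ≠ i ∧ l ≠ j ∧ ∀ m, m ≠ j → m = i ∨ m = l := by
    decide
  -- an edge `i → j` (a dual of `f i` in `H_j` missing `f j`) makes `j` receive a bi-dual (stub α)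
  have edge : ∀ i j : Fin 3, i ≠ j → ∀ y' : Set M, IsCurve T y' →
      BoundsDisc T (spineHandlebody T j) y' → MeetsOnceTransv y' (f i) → Disjoint y' (f j) → In j := by
    intro i j hij y' hy hby hm hd
    obtain ⟨l, hli, hlj, hcases⟩ := third i j hij
    obtain ⟨y'', hy'', hby'', hd'', hmi, hml⟩ := hα M k T hT f hf i j l hij hli.symm hlj.symm y' hy hby hm hd
    refine ⟨y'', hy'', hby'', hd'', fun m hm' => ?_⟩
    rcases hcases m hm' with rfl | rfl
    · exact hmi
    · exact hml
  have hpair : ∀ i j : Fin 3, i ≠ j → In j ∨ In i := by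
    intro i j hij
    rcases hduals i j hij with ⟨y', hy, hby, hm, hd⟩ | ⟨x', hx, hbx, hm, hd⟩
    · exact Or.inl (edge i j hij y' hy hby hm hd)
    · exact Or.inr (edge j i hij.symm x' hx hbx hm hd)
  -- two distinct colours receive bi-duals
  have htwo : ∃ j l : Fin 3, j ≠ l ∧ In j ∧ In l := by
    by_cases h0 : In 0
    · rcases hpair 1 2 (by decide) with h | h
      · exact ⟨0, 2, by decide, h0, h⟩
      · exact ⟨0, 1, by decide, h0, h⟩
    · have h1 : In 1 := (hpair 0 1 (by decide)).resolve_right h0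
      have h2 : In 2 := (hpair 0 2 (by decide)).resolve_right h0
      exact ⟨1, 2, by decide, h1, h2⟩
  obtain ⟨j, l, hjl, ⟨nj, hcnj, hbnj, hnjfj, hnj⟩, ⟨nl, hcnl, hbnl, hnlfl, hnl⟩⟩ := htwo
  obtain ⟨p, hpj, hpl, -⟩ := third j l hjl
  -- the fork at `p`; stub β makes the neighbours disjoint
  obtain ⟨nl', hcnl', hbnl', hnl'fl, hnl'p, hnl'j, hdisj⟩ := hβ M k T hT f hf p j l hpj hpl hjl nj nl
    hcnj hcnl hbnj hbnl hnjfj hnlfl (hnj p hpj) (hnj l hjl.symm) (hnl p hpl) (hnl j hjl)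
  exact ⟨p, j, l, nj, nl', hpj, hpl, hjl, hcnj, hcnl', hbnj, hbnl', hdisj, hnjfj, hnl'fl,
    hnj p hpj, hnl'p, hnj l hjl.symm, hnl'j⟩


end Summit.SmoothPoincare4.SmoothPoincare4.Theorems

end
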